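/-
Width seat `ym-line-cbag-p1-w3` (prover-ym-line-cbag-p1-w3-g8-0), the only seat on LINE 3 `route-QuantumFields-SixPlaneColdBox`: the infrared stub
of crux `TorusMeanNearColdBoxG` (stmt-QuantumFields-25708) at ceiling `θ₁ ≤ 1/200`, hence the crux, the target `BulkDominatesBoxDensityG`
(stmt-QuantumFields-25707) and the node `LatticeNonFreezing`.
-/
import Summits.QuantumFields.YangMills.Theorems.SixPlaneColdBoxEquipartitionRate
import Summits.QuantumFields.YangMills.Theorems.SixPlaneColdBoxTorusMeanInputs
import Summits.QuantumFields.YangMills.Theorems.SixPlaneColdBoxTorusMeanNearOfTopBox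
import Summits.QuantumFields.YangMills.Theorems.EquipartitionCriticalityEquipartitionPinsProbeTangentDefs
import Summits.QuantumFields.YangMills.Theorems.HankelDensitySplittingTorusLimitTransfer
import Summits.QuantumFields.YangMills.Theorems.CurvatureBoostCovariance.Negative.BetaZeroMoments
import Literature.MathematicalPhysics.QuantumFieldTheory.LatticeGaugeProofs

/-!
# Route `SixPlaneColdBox`, crux `TorusMeanNearColdBoxG`: the infrared stub, proved

For every compact simple `G` and faithful unitary lattice representation `r` (`D = dim_ℝ 𝔤_r`):

* `limitMean_le` — every torus-limit state at large `β` has, in EVERY plane `q`, `β·E_μ[c_q] ≤ D/4 + Cₑβ^{−κ'} + (5D/2)K/⌈β^θ⌉⁴ + 20β^{−1/4}`: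
  the total over the six planes is `≤ 3D/2 + Cₑβ^{−κ'}` (`equipartitionRate_upper`, from the CLOSED crux `FreeEnergyRate`), and each of the other
  five planes is `≥ D/4 − (D/2)K/⌈β^θ⌉⁴ − 4β^{−1/4}` (`limitMean_ge_boxMean` + `boxMean_centre_ge`: the cold box is colder and sits at the free value);
* `eventually_torusMean_le` — an upper bound valid for all limit states at `β` holds, up to any `δ > 0`, on all large odd tori (compactness,
  p1's `HankelDensitySplitting.exists_isInfiniteVolumeLimitAlong_comp`);
* `torusMeanNearTopBoxG` — the registered stub 1 of the birth skeleton of crux `TorusMeanNearColdBoxG` with ceiling `θ₁ ≤ 1/200`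
  (`θ₁ = min (1/200) (κ'/8)`, `m = 2(θ₁ − A)`);
* `torusMeanNearColdBoxG_proof : TorusMeanNearColdBoxG` (via `torusMeanNearColdBoxG_of_topBox`).

HONEST LABEL: these are statements about the torus plaquette MEAN at next-to-leading precision (Chatterjee's free-energy asymptotics with a power
rate + convexity + the cold-box comparison); no clustering, no mass gap.  The Yang–Mills mass gap is NOT proved here.
-/

set_option autoImplicit false

noncomputable section

open MeasureTheory ProbabilityTheory Finset Real Filter Topology Metric
open scoped ENNReal
open Literature.Probability.LatticeModels (Site)
open Literature.MathematicalPhysics.QuantumLattice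
open Literature.MathematicalPhysics.QuantumFieldTheory
open Summit.QuantumFields.YangMills.Theorems.WeakCouplingRates
open Summit.QuantumFields.YangMills.Theorems.FreeEnergyLogCoefficient
open Summit.QuantumFields.YangMills.Theorems.ColdBoxAllGroups
open Summit.QuantumFields.YangMills.Theses.SixPlaneColdBox (TorusMeanNearColdBoxG)

namespace Summit.QuantumFields.YangMills.Theorems.SixPlaneColdBox


/-! ## Per-plane upper bound for torus-limit states -/

/-- **Every plane is equipartitioned from above, uniformly over torus-limit states.**  For every compact simple `G`, `r` and `0 < θ ≤ 1/200` there
are `Cₑ, κ' > 0, K ≥ 0, β₁` with, for `β ≥ β₁`, every `μ ∈ infiniteVolumeLimitPoints r.ρ β` and every plane `q`,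
`β·E_μ[N − Re tr r(U_{(0;q)})] ≤ D/4 + Cₑβ^{−κ'} + (5D/2)K/⌈β^θ⌉⁴ + 20β^{−1/4}`, `D = dimE r.ρ`. -/
theorem limitMean_le
    (G : Type) [Group G] [TopologicalSpace G] [IsTopologicalGroup G] [CompactSpace G] (hG : IsCompactSimpleLieGroup G) :
    letI : MeasurableSpace G := borel G
    haveI : BorelSpace G := ⟨rfl⟩
    ∀ r : LatticeRep G, ∃ Cₑ κ' : ℝ, 0 < κ' ∧ ∀ θ : ℝ, 0 < θ → θ ≤ 1 / 200 → ∃ K β₁ : ℝ, 0 ≤ K ∧ ∀ β : ℝ, β₁ ≤ β →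
      ∀ μ ∈ infiniteVolumeLimitPoints (d := 4) r.ρ β, ∀ q : {q : Fin 4 × Fin 4 // q.1 < q.2},
        β * (∫ U, ((r.N : ℝ) - plaquetteObs r.ρ 0 q.1.1 q.1.2 U) ∂μ) ≤
          (dimE r.ρ : ℝ) / 4 + Cₑ * β ^ (-κ') + 5 * ((dimE r.ρ : ℝ) / 2 * (K / (⌈β ^ θ⌉₊ : ℝ) ^ 4)) + 20 * β ^ (-(1 / 4 : ℝ)) := by
  letI : MeasurableSpace G := borel G
  haveI : BorelSpace G := ⟨rfl⟩
  intro r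
  haveI : SecondCountableTopology G := r.secondCountableTopology
  have hρc : Continuous r.ρ := r.continuous
  obtain ⟨Cₑ, κ', βe, hκ', hE⟩ := equipartitionRate_upper G hG r
  refine ⟨Cₑ, κ', hκ', fun θ hθ hθ2 => ?_⟩
  obtain ⟨βl, hlow⟩ := limitMean_ge_boxMean G hG r hθ hθ2
  obtain ⟨K, hK0, βb, hbox⟩ := boxMean_centre_ge G hG r hθ hθ2
  have hdim : (dimE r.ρ : ℝ) = (Module.finrank ℝ ↥(Submodule.span ℝ {X : Matrix (Fin r.N) (Fin r.N) ℂ |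
      ∀ t : ℝ, NormedSpace.exp ((t : ℂ) • X) ∈ Set.range r.ρ}) : ℝ) := by
    exact_mod_cast EquipartitionPinsProbe.dimE_eq_lieDim r
  refine ⟨K, max (max βe βl) (max βb 1), hK0, fun β hβ μ hμ q₀ => ?_⟩
  simp only [max_le_iff] at hβ
  obtain ⟨⟨hbe, hbl⟩, hbb, hβ1⟩ := hβ
  have hβ0 : 0 < β := by linarith
  obtain ⟨Ls, hLs, hlim⟩ := id hμ
  haveI : IsProbabilityMeasure μ := hlim.1
  -- the per-plane means and their integrability
  have hPabs : ∀ (q : {q : Fin 4 × Fin 4 // q.1 < q.2}) (U : LGConfig 4 G), |plaquetteObs r.ρ 0 q.1.1 q.1.2 U| ≤ r.N := fun q U => by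
    have h := Literature.RepresentationTheory.CompactGroups.CompactGroup.abs_re_trace_le_card r.ρ r.continuous
      (plaquetteHolonomyZd U 0 q.1.1 q.1.2)
    simpa only [Fintype.card_fin, Literature.MathematicalPhysics.QuantumLattice.plaquetteObs] using h
  have hPi : ∀ q : {q : Fin 4 × Fin 4 // q.1 < q.2}, Integrable (fun U => (r.N : ℝ) - plaquetteObs r.ρ 0 q.1.1 q.1.2 U) μ := fun q =>
    (integrable_const _).sub (Integrable.of_bound (continuous_plaquetteObs r.ρ hρc 0 q.1.1 q.1.2).measurable.aestronglyMeasurable (r.N : ℝ)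
      (ae_of_all _ fun U => by rw [Real.norm_eq_abs]; exact hPabs q U))
  set e : {q : Fin 4 × Fin 4 // q.1 < q.2} → ℝ := fun q => ∫ U, ((r.N : ℝ) - plaquetteObs r.ρ 0 q.1.1 q.1.2 U) ∂μ with he
  -- total: `β Σ_q e_q ≤ 3D/2 + Cₑ β^{-κ'}`
  have htot : β * ∑ q, e q ≤ 3 * (dimE r.ρ : ℝ) / 2 + Cₑ * β ^ (-κ') := by
    have h := hE β hbe μ hμ
    have hsum : (∫ U, (∑ i : Fin 4, ∑ j : Fin 4, if i < j then ((r.N : ℝ) - plaquetteObs r.ρ 0 i j U) else 0) ∂μ) = ∑ q, e q := by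
      have hfun : (fun U : LGConfig 4 G => ∑ i : Fin 4, ∑ j : Fin 4, if i < j then ((r.N : ℝ) - plaquetteObs r.ρ 0 i j U) else 0) =
          fun U => ∑ q : {q : Fin 4 × Fin 4 // q.1 < q.2}, ((r.N : ℝ) - plaquetteObs r.ρ 0 q.1.1 q.1.2 U) :=
        funext fun U => (EquipartitionPinsProbe.Equipartition.sum_planes (d := 4)
          (fun i j => (r.N : ℝ) - plaquetteObs r.ρ 0 i j U)).symm
      rw [hfun, integral_finsetSum _ fun q _ => hPi q]
    rw [hsum, ← hdim] at h
    exact h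
  -- each plane: `β e_q ≥ D/4 − (D/2)K/H⁴ − 4β^{-1/4}`
  have hlb : ∀ q, (dimE r.ρ : ℝ) / 2 * (1 / 2) - (dimE r.ρ : ℝ) / 2 * (K / (⌈β ^ θ⌉₊ : ℝ) ^ 4) - 4 * β ^ (-(1 / 4 : ℝ)) ≤ β * e q := by
    intro q
    have h1 := hlow β hbl μ hμ q
    have h2 := hbox β hbb q.1.1 q.1.2 q.2
    have e54 : β * β ^ (-(5 / 4 : ℝ)) = β ^ (-(1 / 4 : ℝ)) := by
      rw [← Real.rpow_one_add' hβ0.le (by norm_num)]; norm_num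
    have h3 := mul_le_mul_of_nonneg_left h1 hβ0.le
    rw [mul_sub, show β * (3 * β ^ (-(5 / 4 : ℝ))) = 3 * (β * β ^ (-(5 / 4 : ℝ))) by ring, e54] at h3
    simp only [he]
    linarith
  -- split off `q₀`
  have hsplit : ∑ q, β * e q = β * e q₀ + ∑ q ∈ (Finset.univ.erase q₀), β * e q :=
    (Finset.add_sum_erase _ _ (Finset.mem_univ q₀)).symm
  have hcard : ((Finset.univ : Finset {q : Fin 4 × Fin 4 // q.1 < q.2}).erase q₀).card = 5 := by
    rw [Finset.card_erase_of_mem (Finset.mem_univ q₀), Finset.card_univ, CurvatureBoostCovariance.Negative.card_planes]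
  have hrest : (5 : ℝ) * ((dimE r.ρ : ℝ) / 2 * (1 / 2) - (dimE r.ρ : ℝ) / 2 * (K / (⌈β ^ θ⌉₊ : ℝ) ^ 4) - 4 * β ^ (-(1 / 4 : ℝ))) ≤
      ∑ q ∈ (Finset.univ.erase q₀), β * e q := by
    have h := Finset.card_nsmul_le_sum (Finset.univ.erase q₀) (fun q => β * e q)
      ((dimE r.ρ : ℝ) / 2 * (1 / 2) - (dimE r.ρ : ℝ) / 2 * (K / (⌈β ^ θ⌉₊ : ℝ) ^ 4) - 4 * β ^ (-(1 / 4 : ℝ))) (fun q _ => hlb q)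
    rw [hcard, nsmul_eq_mul] at h
    exact_mod_cast h
  have hsum' : β * ∑ q, e q = ∑ q, β * e q := Finset.mul_sum _ _ _
  rw [hsum', hsplit] at htot
  simp only [he] at htot hrest ⊢
  linarith

/-! ## From limit states to large tori -/

/-- **Upper bounds valid for all torus-limit states hold eventually on the tori** (up to any `δ > 0`): if `E_ν[N − Re tr r(U_{(0;q)})] ≤ B` for every
`ν ∈ infiniteVolumeLimitPoints ρ β`, then `E_{torus 2S+1}[plaqCost0 q ∘ torusLift] ≤ B + δ` for all large `S` (compactness). -/
theorem eventually_torusMean_le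
    {N : ℕ} {G : Type} [Group G] [TopologicalSpace G] [IsTopologicalGroup G] [CompactSpace G] [MeasurableSpace G] [BorelSpace G]
    [T2Space G] [SecondCountableTopology G] (ρ : G →* Matrix (Fin N) (Fin N) ℂ) (hρ : Continuous ρ) (β : ℝ) {B δ : ℝ} (hδ : 0 < δ)
    (q : {q : Fin 4 × Fin 4 // q.1 < q.2})
    (hB : ∀ ν ∈ infiniteVolumeLimitPoints (d := 4) ρ β, ∫ U, ((N : ℝ) - plaquetteObs ρ 0 q.1.1 q.1.2 U) ∂ν ≤ B) :
    ∃ S₀ : ℕ, ∀ S : ℕ, S₀ ≤ S →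
      (∫ U, plaqCost0 ρ q.1.1 q.1.2 (torusLift (2 * S + 1) U) ∂(wilsonMeasure (d := 4) (L := 2 * S + 1) ρ β)) ≤ B + δ := by
  have hPabs : ∀ U : LGConfig 4 G, |plaquetteObs ρ 0 q.1.1 q.1.2 U| ≤ N := fun U => by
    have h := Literature.RepresentationTheory.CompactGroups.CompactGroup.abs_re_trace_le_card ρ hρ (plaquetteHolonomyZd U 0 q.1.1 q.1.2)
    simpa only [Fintype.card_fin, Literature.MathematicalPhysics.QuantumLattice.plaquetteObs] using h
  by_contra hcon
  push Not at hcon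
  -- a strictly increasing sequence of bad odd tori
  have hfreq : ∃ᶠ S : ℕ in atTop, B + δ <
      ∫ U, plaqCost0 ρ q.1.1 q.1.2 (torusLift (2 * S + 1) U) ∂(wilsonMeasure (d := 4) (L := 2 * S + 1) ρ β) :=
    Filter.frequently_atTop.2 fun S₀ => hcon S₀
  obtain ⟨φ, hφ, hbad⟩ := Filter.extraction_of_frequently_atTop hfreq
  have hLs : StrictMono fun k => 2 * φ k := fun a b hab => by have h := hφ hab; show 2 * φ a < 2 * φ b; omega
  obtain ⟨ν, ψ, hψ, hconv, hν⟩ := HankelDensitySplitting.exists_isInfiniteVolumeLimitAlong_comp (d := 4) ρ hρ β hLs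
  haveI : IsProbabilityMeasure ν := hconv.1
  have htend := hconv.2 (plaquetteObs ρ 0 q.1.1 q.1.2) _ (isCylinder_plaquetteObs ρ (((0 : Site 4), q) : ZdPlaquette 4))
    (continuous_plaquetteObs ρ hρ 0 q.1.1 q.1.2) ⟨N, hPabs⟩
  -- along the bad tori the plaquette expectation is `< N − B − δ`
  have hev : ∀ k : ℕ, wilsonExpectation (L := (fun k => 2 * φ k) (ψ k) + 1) ρ β
      (toTorusObservable ((fun k => 2 * φ k) (ψ k) + 1) (plaquetteObs ρ 0 q.1.1 q.1.2)) ≤ (N : ℝ) - B - δ := by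
    intro k
    have h := hbad (ψ k)
    haveI := isProbabilityMeasure_wilsonMeasure (d := 4) (L := 2 * φ (ψ k) + 1) (G := G) ρ hρ β
    have hPi : Integrable (fun U : GaugeConfig 4 (2 * φ (ψ k) + 1) G => plaquetteObs ρ 0 q.1.1 q.1.2 (torusLift (2 * φ (ψ k) + 1) U))
        (wilsonMeasure (d := 4) (L := 2 * φ (ψ k) + 1) ρ β) :=
      Integrable.of_bound (((continuous_plaquetteObs ρ hρ 0 q.1.1 q.1.2).measurable.comp
        (measurable_torusLift (d := 4) (G := G) (2 * φ (ψ k) + 1))).aestronglyMeasurable) (N : ℝ)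
        (ae_of_all _ fun U => by rw [Real.norm_eq_abs]; exact hPabs _)
    have e : ∫ U, plaqCost0 ρ q.1.1 q.1.2 (torusLift (2 * φ (ψ k) + 1) U) ∂(wilsonMeasure (d := 4) (L := 2 * φ (ψ k) + 1) ρ β) =
        (N : ℝ) - ∫ U, plaquetteObs ρ 0 q.1.1 q.1.2 (torusLift (2 * φ (ψ k) + 1) U) ∂(wilsonMeasure (d := 4) (L := 2 * φ (ψ k) + 1) ρ β) := by
      simp only [plaqCost0]
      rw [integral_sub (integrable_const _) hPi, integral_const, smul_eq_mul, probReal_univ, one_mul]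
    rw [e] at h
    show ∫ U, plaquetteObs ρ 0 q.1.1 q.1.2 (torusLift (2 * φ (ψ k) + 1) U) ∂(wilsonMeasure (d := 4) (L := 2 * φ (ψ k) + 1) ρ β) ≤ (N : ℝ) - B - δ
    linarith
  have hle : ∫ U, plaquetteObs ρ 0 q.1.1 q.1.2 U ∂ν ≤ (N : ℝ) - B - δ := le_of_tendsto' htend hev
  have hPiν : Integrable (plaquetteObs ρ 0 q.1.1 q.1.2) ν :=
    Integrable.of_bound (continuous_plaquetteObs ρ hρ 0 q.1.1 q.1.2).measurable.aestronglyMeasurable (N : ℝ)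
      (ae_of_all _ fun U => by rw [Real.norm_eq_abs]; exact hPabs U)
  have hBν := hB ν hν
  rw [integral_sub (integrable_const _) hPiν, integral_const, smul_eq_mul, probReal_univ, one_mul] at hBν
  linarith

/-! ## The infrared stub, the crux -/

/-- **Registered stub 1 of crux `TorusMeanNearColdBoxG`, with ceiling `θ₁ ≤ 1/200`: the torus plaquette mean exceeds the cold-box centre mean at the
top scale by at most `β^{−(1+4A+m)}`.**  (`θ₁ = min (1/200) (κ'/8)`, `m = 2(θ₁ − A)`; equipartition with a rate for the torus-limit states, the
cold box at the free value, compactness.) -/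
theorem torusMeanNearTopBoxG :
    ∀ (G : Type) [Group G] [TopologicalSpace G] [IsTopologicalGroup G] [CompactSpace G],
      IsCompactSimpleLieGroup G →
        letI : MeasurableSpace G := borel G
        haveI : BorelSpace G := ⟨rfl⟩
        ∀ r : LatticeRep G, ∃ θ₁ : ℝ, 0 < θ₁ ∧ θ₁ ≤ 1 / 200 ∧ ∀ A : ℝ, 0 < A → A < θ₁ → ∃ m : ℝ, 0 < m ∧
          ∃ β₀ : ℝ, ∀ β : ℝ, β₀ ≤ β → ∃ S₀ : ℕ, ∀ S : ℕ, S₀ ≤ S → ∀ i j : Fin 4, i < j →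
            (∫ U, plaqCost0 r.ρ i j (torusLift (2 * S + 1) U) ∂(wilsonMeasure (d := 4) (L := 2 * S + 1) r.ρ β)) -
                (∫ U, plaqCostAt r.ρ (boxCentre ⌈β ^ θ₁⌉₊) i j U ∂(boxState r.ρ β ⌈β ^ θ₁⌉₊)) ≤
              β ^ (-(1 + 4 * A + m)) := by
  intro G _ _ _ _ hG
  letI : MeasurableSpace G := borel G
  haveI : BorelSpace G := ⟨rfl⟩
  intro r
  haveI : SecondCountableTopology G := r.secondCountableTopology
  haveI : T2Space G := (r.continuous.isClosedEmbedding r.injective).isEmbedding.t2Space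
  have hρc : Continuous r.ρ := r.continuous
  obtain ⟨Cₑ, κ', hκ', hrest⟩ := limitMean_le G hG r
  -- the top scale
  set θ₁ : ℝ := min (1 / 200) (κ' / 8) with hθ₁
  have hθ₁0 : 0 < θ₁ := lt_min (by norm_num) (by positivity)
  have hθ₁1 : θ₁ ≤ 1 / 200 := min_le_left _ _
  have hθ₁2 : θ₁ ≤ κ' / 8 := min_le_right _ _
  obtain ⟨K, β₁, hK0, hup⟩ := hrest θ₁ hθ₁0 hθ₁1
  obtain ⟨Kb, hKb0, βb, hbox⟩ := boxMean_centre_ge G hG r hθ₁0 hθ₁1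
  refine ⟨θ₁, hθ₁0, hθ₁1, fun A hA hAθ => ?_⟩
  -- the margin
  set m : ℝ := 2 * (θ₁ - A) with hm
  have hm0 : 0 < m := by rw [hm]; linarith
  set s : ℝ := 4 * A + m with hs
  have hs_eq : s = 2 * A + 2 * θ₁ := by rw [hs, hm]; ring
  have hs0 : 0 < s := by rw [hs_eq]; positivity
  have hgap1 : -κ' < -s := by rw [hs_eq]; linarith
  have hgap2 : -(4 * θ₁) < -s := by rw [hs_eq]; linarith
  have hgap3 : -(1 / 4 : ℝ) < -s := by rw [hs_eq]; linarith
  set D : ℝ := (dimE r.ρ : ℝ) with hD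
  have hD0 : 0 ≤ D := Nat.cast_nonneg _
  obtain ⟨βp1, hβp1_1, hp1⟩ := exists_const_mul_rpow_le_rpow (4 * |Cₑ|) hgap1
  obtain ⟨βp2, -, hp2⟩ := exists_const_mul_rpow_le_rpow (4 * (5 * (D / 2) * K + D / 2 * Kb)) hgap2
  obtain ⟨βp3, -, hp3⟩ := exists_const_mul_rpow_le_rpow (4 * 21) hgap3
  refine ⟨m, hm0, max (max β₁ βb) (max (max βp1 βp2) (max βp3 1)), fun β hβ => ?_⟩
  simp only [max_le_iff] at hβ
  obtain ⟨⟨hb1, hbb⟩, ⟨hbp1, hbp2⟩, hbp3, hβ1⟩ := hβ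
  have hβ0 : 0 < β := by linarith
  -- the slack `δ := β^{-(1+s)}/4` and the torus side on large tori, every plane
  set δ : ℝ := β ^ (-(1 + s)) / 4 with hδ
  have hδ0 : 0 < δ := by positivity
  set B : {q : Fin 4 × Fin 4 // q.1 < q.2} → ℝ := fun _ =>
    ((D / 4 + Cₑ * β ^ (-κ') + 5 * (D / 2 * (K / (⌈β ^ θ₁⌉₊ : ℝ) ^ 4)) + 20 * β ^ (-(1 / 4 : ℝ))) / β) with hB
  have hBlim : ∀ (q : {q : Fin 4 × Fin 4 // q.1 < q.2}), ∀ ν ∈ infiniteVolumeLimitPoints (d := 4) r.ρ β,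
      ∫ U, ((r.N : ℝ) - plaquetteObs r.ρ 0 q.1.1 q.1.2 U) ∂ν ≤ B q := by
    intro q ν hν
    have h := hup β hb1 ν hν q
    rw [hB, le_div_iff₀ hβ0, mul_comm]
    exact h
  choose S₀ hS₀ using fun q : {q : Fin 4 × Fin 4 // q.1 < q.2} => eventually_torusMean_le r.ρ hρc β hδ0 q (hBlim q)
  refine ⟨Finset.univ.sup S₀, fun S hS i j hij => ?_⟩
  set q : {q : Fin 4 × Fin 4 // q.1 < q.2} := ⟨(i, j), hij⟩ with hq
  have hSq : S₀ q ≤ S := (Finset.le_sup (Finset.mem_univ q)).trans hS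
  have hT : (∫ U, plaqCost0 r.ρ i j (torusLift (2 * S + 1) U) ∂(wilsonMeasure (d := 4) (L := 2 * S + 1) r.ρ β)) ≤ B q + δ :=
    hS₀ q S hSq
  -- the box side at the top scale
  have hBx := hbox β hbb i j hij
  -- `1/⌈β^θ₁⌉⁴ ≤ β^{-4θ₁}`
  have hHge : β ^ θ₁ ≤ (⌈β ^ θ₁⌉₊ : ℝ) := Nat.le_ceil _
  have hHpos : 0 < (⌈β ^ θ₁⌉₊ : ℝ) := lt_of_lt_of_le (Real.rpow_pos_of_pos hβ0 _) hHge
  have hH4 : 1 / (⌈β ^ θ₁⌉₊ : ℝ) ^ 4 ≤ β ^ (-(4 * θ₁)) := by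
    have h1 : (β ^ θ₁) ^ 4 ≤ (⌈β ^ θ₁⌉₊ : ℝ) ^ 4 := pow_le_pow_left₀ (by positivity) hHge 4
    have h2 : (β ^ θ₁) ^ 4 = β ^ (4 * θ₁) := by
      rw [← Real.rpow_natCast (β ^ θ₁) 4, ← Real.rpow_mul hβ0.le]; norm_num; ring_nf
    rw [h2] at h1
    rw [div_le_iff₀ (by positivity), Real.rpow_neg hβ0.le]
    have h3 : 0 < β ^ (4 * θ₁) := by positivity
    calc (1 : ℝ) = (β ^ (4 * θ₁))⁻¹ * β ^ (4 * θ₁) := by rw [inv_mul_cancel₀ h3.ne']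
      _ ≤ (β ^ (4 * θ₁))⁻¹ * (⌈β ^ θ₁⌉₊ : ℝ) ^ 4 := mul_le_mul_of_nonneg_left h1 (by positivity)
  -- the three error pieces against `β^{-s}/4`
  have e1 : |Cₑ| * β ^ (-κ') ≤ β ^ (-s) / 4 := by have := hp1 β hbp1; linarith
  have e2 : (5 * (D / 2) * K + D / 2 * Kb) * β ^ (-(4 * θ₁)) ≤ β ^ (-s) / 4 := by have := hp2 β hbp2; linarith
  have e3 : 21 * β ^ (-(1 / 4 : ℝ)) ≤ β ^ (-s) / 4 := by have := hp3 β hbp3; linarith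
  have eδ : β * δ = β ^ (-s) / 4 := by
    rw [hδ, show -(1 + s) = -s + (-1 : ℝ) by ring, Real.rpow_add hβ0, Real.rpow_neg_one]
    field_simp
  -- `β·(E_S − E_box) ≤ β^{-s}`
  have hCe : Cₑ * β ^ (-κ') ≤ |Cₑ| * β ^ (-κ') := mul_le_mul_of_nonneg_right (le_abs_self _) (by positivity)
  have hKH : 5 * (D / 2 * (K / (⌈β ^ θ₁⌉₊ : ℝ) ^ 4)) + D / 2 * (Kb / (⌈β ^ θ₁⌉₊ : ℝ) ^ 4) ≤
      (5 * (D / 2) * K + D / 2 * Kb) * β ^ (-(4 * θ₁)) := by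
    have e : 5 * (D / 2 * (K / (⌈β ^ θ₁⌉₊ : ℝ) ^ 4)) + D / 2 * (Kb / (⌈β ^ θ₁⌉₊ : ℝ) ^ 4) =
        (5 * (D / 2) * K + D / 2 * Kb) * (1 / (⌈β ^ θ₁⌉₊ : ℝ) ^ 4) := by ring
    rw [e]
    exact mul_le_mul_of_nonneg_left hH4 (by positivity)
  have hTβ : β * (∫ U, plaqCost0 r.ρ i j (torusLift (2 * S + 1) U) ∂(wilsonMeasure (d := 4) (L := 2 * S + 1) r.ρ β)) ≤
      D / 4 + Cₑ * β ^ (-κ') + 5 * (D / 2 * (K / (⌈β ^ θ₁⌉₊ : ℝ) ^ 4)) + 20 * β ^ (-(1 / 4 : ℝ)) + β * δ := by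
    have h := mul_le_mul_of_nonneg_left hT hβ0.le
    have e : β * (B q + δ) = D / 4 + Cₑ * β ^ (-κ') + 5 * (D / 2 * (K / (⌈β ^ θ₁⌉₊ : ℝ) ^ 4)) + 20 * β ^ (-(1 / 4 : ℝ)) + β * δ := by
      rw [hB]; field_simp
    linarith
  have key : β * ((∫ U, plaqCost0 r.ρ i j (torusLift (2 * S + 1) U) ∂(wilsonMeasure (d := 4) (L := 2 * S + 1) r.ρ β)) -
      (∫ U, plaqCostAt r.ρ (boxCentre ⌈β ^ θ₁⌉₊) i j U ∂(boxState r.ρ β ⌈β ^ θ₁⌉₊))) ≤ β ^ (-s) := by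
    rw [mul_sub]
    linarith [hTβ, hBx, hCe, hKH, e1, e2, e3, eδ]
  -- divide by `β`
  have hfin : (∫ U, plaqCost0 r.ρ i j (torusLift (2 * S + 1) U) ∂(wilsonMeasure (d := 4) (L := 2 * S + 1) r.ρ β)) -
      (∫ U, plaqCostAt r.ρ (boxCentre ⌈β ^ θ₁⌉₊) i j U ∂(boxState r.ρ β ⌈β ^ θ₁⌉₊)) ≤ β ^ (-s) / β := by
    rw [le_div_iff₀ hβ0, mul_comm]; exact key
  have epow : β ^ (-s) / β = β ^ (-(1 + 4 * A + m)) := by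
    have e : -(1 + 4 * A + m) = -s + (-1 : ℝ) := by rw [hs]; ring
    rw [e, Real.rpow_add hβ0, Real.rpow_neg_one, div_eq_mul_inv]
  rw [← epow]; exact hfin

/-- **Crux `TorusMeanNearColdBoxG` of route `SixPlaneColdBox` (stmt-QuantumFields-25708), proved**: the top-box infrared stub
(`torusMeanNearTopBoxG`) composed with the landed nested-box comparison (`torusMeanNearColdBoxG_of_topBox`). -/
theorem torusMeanNearColdBoxG_proof : Summit.QuantumFields.YangMills.Theses.SixPlaneColdBox.TorusMeanNearColdBoxG :=
  torusMeanNearColdBoxG_of_topBox torusMeanNearTopBoxG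

end Summit.QuantumFields.YangMills.Theorems.SixPlaneColdBox

end
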